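import Mathlib
import Summits.Ventures.DiscreteObjects.Mahler.CyclotomicIntegerMeasure

/-!
# Cyclotomic integers: the explicit trace descent `g(ζ) = (contract_p g)(ζ^p)` for `σ`-invariant elements, `p² ∣ m` (venture `DiscreteObjects`, target L)

Cell `pub-namedobj`, seat `pub-namedobj-mahler-g27`. Framing: lottery ticket; floor = certified bounds/negative ranges.

Infrastructure for the degenerate case of [cite: BombieriGubler2001, Theorem 4.4.9, Case II] ("`ζ γ` is contained in the
proper cyclotomic subfield `C_{m/p}`"): when `p² ∣ m` (so `m ∣ N²` for `N = (m/p)·t`), the automorphisms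
`σ^j : ζ ↦ ζ^{(1+N)^j}` of `ℚ(ζ_m)` over `ℚ(ζ_m^p)` act by `ζ ↦ ζ · ω^j`, `ω = ζ^N` a `p`-th root of unity
(`pow_one_add_pow_mod`), and the trace identity `∑_{j<p} g(ζ ω^j) = p · (contract_p g)(ζ^p)` (`sum_aeval_mul_pow_eq`, for any
`ζ` and any primitive `p`-th root `ω`) gives the EXPLICIT descent: **if `g(μ^{1+N}) = g(μ)` for every primitive `m`-th root
`μ` (with `p ∤ t`), then `g(ζ) = (contract_p g)(ζ^p)`** (`aeval_eq_aeval_contract_of_invariant`), i.e. the `σ`-invariant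
cyclotomic integer `g(ζ_m)` is the explicit integer polynomial `contract_p g` in `ζ_m^p = ζ_{m/p}`.  (The case `p ∥ m` of the
descent needs a relative power-basis argument and is not done here.)  Elementary; no new mathematics.
-/

namespace Summit.Ventures.DiscreteObjects.Mahler

open Polynomial Finset

/-- If `m ∣ N²` then `(1 + N)^j ≡ 1 + jN (mod m)`. -/
theorem pow_one_add_pow_mod {m N : ℕ} (hN : m ∣ N * N) (j : ℕ) : (1 + N) ^ j % m = (1 + j * N) % m := by
  induction j with
  | zero => simp
  | succ j ih =>
    have h : Nat.ModEq m ((1 + N) ^ j) (1 + j * N) := ih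
    have h2 : Nat.ModEq m ((1 + N) ^ (j + 1)) ((1 + j * N) * (1 + N)) := by
      rw [pow_succ]
      exact h.mul_right _
    have h3 : (1 + j * N) * (1 + N) = (1 + (j + 1) * N) + j * (N * N) := by ring
    have h4 : Nat.ModEq m ((1 + (j + 1) * N) + j * (N * N)) (1 + (j + 1) * N) := by
      have : Nat.ModEq m (j * (N * N)) 0 := (Nat.modEq_zero_iff_dvd.2 (dvd_mul_of_dvd_right hN j))
      simpa using (Nat.ModEq.refl (1 + (j + 1) * N)).add this
    rw [h3] at h2
    exact h2.trans h4

/-- Powers of a root of unity only depend on the exponent modulo the order. -/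
theorem pow_eq_pow_of_mod_eq {μ : ℂ} {m a b : ℕ} (hμ : μ ^ m = 1) (h : a % m = b % m) : μ ^ a = μ ^ b := by
  rw [← Nat.div_add_mod a m, ← Nat.div_add_mod b m, pow_add, pow_add, pow_mul, pow_mul, hμ, one_pow, one_pow, h]

/-- `contract` is additive. -/
theorem contract_add' {p : ℕ} (hp : p ≠ 0) (f g : ℤ[X]) : contract p (f + g) = contract p f + contract p g := by
  ext n
  simp only [coeff_contract hp, coeff_add]

/-- `contract` of a monomial. -/
theorem contract_monomial' {p : ℕ} (hp : p ≠ 0) (i : ℕ) (a : ℤ) :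
    contract p (monomial i a) = if p ∣ i then monomial (i / p) a else 0 := by
  ext k
  rw [coeff_contract hp, coeff_monomial]
  by_cases hpi : p ∣ i
  · rw [if_pos hpi, coeff_monomial]
    obtain ⟨q, hq⟩ := hpi
    subst hq
    rw [Nat.mul_div_cancel_left q (Nat.pos_of_ne_zero hp)]
    by_cases hqk : q = k
    · subst hqk
      rw [if_pos (mul_comm p q), if_pos rfl]
    · rw [if_neg hqk, if_neg]
      intro h
      apply hqk
      rw [mul_comm] at h
      exact Nat.eq_of_mul_eq_mul_right (Nat.pos_of_ne_zero hp) h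
  · rw [if_neg hpi, coeff_zero, if_neg]
    intro h
    apply hpi
    rw [h]
    exact Dvd.intro_left k rfl

/-- **Trace identity.**  For `ζ ∈ ℂ`, a primitive `p`-th root of unity `ω` and `f ∈ ℤ[X]`:
`∑_{j<p} f(ζ ω^j) = p · (contract_p f)(ζ^p)`. -/
theorem sum_aeval_mul_pow_eq {p : ℕ} (hp : p.Prime) {ω : ℂ} (hω : IsPrimitiveRoot ω p) (ζ : ℂ) (f : ℤ[X]) :
    ∑ j ∈ range p, aeval (ζ * ω ^ j) f = (p : ℂ) * aeval (ζ ^ p) (contract p f) := by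
  induction f using Polynomial.induction_on' with
  | add f g hf hg =>
    rw [contract_add' hp.ne_zero, map_add]
    simp only [map_add, Finset.sum_add_distrib, hf, hg]
    ring
  | monomial i a =>
    rw [contract_monomial' hp.ne_zero]
    simp only [aeval_monomial, algebraMap_int_eq, eq_intCast]
    have hsplit : ∀ j : ℕ, (ζ * ω ^ j) ^ i = ζ ^ i * (ω ^ i) ^ j := by
      intro j; rw [mul_pow, ← pow_mul, ← pow_mul, mul_comm j i]
    simp_rw [hsplit, ← Finset.mul_sum]
    by_cases hpi : p ∣ i
    · rw [if_pos hpi, aeval_monomial, algebraMap_int_eq, eq_intCast]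
      obtain ⟨q, hq⟩ := hpi
      have hωi : ω ^ i = 1 := by rw [hq, pow_mul, hω.pow_eq_one, one_pow]
      rw [hωi]
      simp only [one_pow, Finset.sum_const, Finset.card_range, nsmul_eq_mul, mul_one]
      rw [hq, Nat.mul_div_cancel_left q hp.pos, ← pow_mul]
      ring
    · rw [if_neg hpi, map_zero, mul_zero]
      have hωi : IsPrimitiveRoot (ω ^ i) p :=
        hω.pow_of_coprime i ((Nat.Prime.coprime_iff_not_dvd hp).2 hpi).symm
      rw [hωi.geom_sum_eq_zero hp.one_lt, mul_zero, mul_zero]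

/-- **Explicit descent for `σ`-invariant cyclotomic integers (`p² ∣ m`).**  Let `m = p·n` with `p ∣ n` (`p` prime),
`ζ` a primitive `m`-th root of unity, `t` prime to `p`, and `g ∈ ℤ[X]` with `g(μ^{1+nt}) = g(μ)` for every primitive
`m`-th root of unity `μ`.  Then `g(ζ) = (contract_p g)(ζ^p)` — an explicit integer polynomial in `ζ^p = ζ_{m/p}`. -/
theorem aeval_eq_aeval_contract_of_invariant {m p n t : ℕ} (hm0 : 0 < m) (hp : p.Prime) (hm : m = p * n)
    (hpn : p ∣ n) (ht : ¬ p ∣ t) (g : ℤ[X]) {ζ : ℂ} (hζ : IsPrimitiveRoot ζ m)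
    (hinv : ∀ μ : ℂ, IsPrimitiveRoot μ m → aeval (μ ^ (1 + n * t)) g = aeval μ g) :
    aeval ζ g = aeval (ζ ^ p) (contract p g) := by
  have hn0 : 0 < n := by
    rcases Nat.eq_zero_or_pos n with h | h
    · exfalso; rw [h, mul_zero] at hm; omega
    · exact h
  set N : ℕ := n * t with hNdef
  -- `1 + N` is prime to `m`
  have hcop : (1 + N).Coprime m := by
    rw [hm]
    refine Nat.Coprime.mul_right ?_ ?_
    · refine ((Nat.Prime.coprime_iff_not_dvd hp).2 ?_).symm
      intro h
      have h2 : p ∣ N := dvd_mul_of_dvd_left hpn t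
      have : p ∣ 1 := (Nat.dvd_add_right h2).1 (by rwa [add_comm] at h)
      exact hp.one_lt.ne' (Nat.dvd_one.1 this)
    · have h2 : n ∣ N := dvd_mul_right n t
      obtain ⟨q, hq⟩ := h2
      rw [hq, show 1 + n * q = 1 + q * n by ring, Nat.coprime_add_mul_right_left]
      exact Nat.coprime_one_left n
  -- `m ∣ N²`
  have hN2 : m ∣ N * N := by
    obtain ⟨q, hq⟩ := hpn
    rw [hm, hNdef, hq]
    exact ⟨q * t * t, by ring⟩
  -- iterate the invariance: `g(ζ^{(1+N)^j}) = g(ζ)`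
  have hiter : ∀ j : ℕ, aeval (ζ ^ (1 + N) ^ j) g = aeval ζ g := by
    intro j
    induction j with
    | zero => simp
    | succ j ih =>
      rw [pow_succ, pow_mul]
      rw [hinv _ ((hζ.pow_of_coprime _ (Nat.Coprime.pow_left j hcop)))]
      exact ih
  -- `ζ^{(1+N)^j} = ζ · ω^j`, `ω = ζ^N` a primitive `p`-th root of unity
  set ω : ℂ := ζ ^ N with hωdef
  have hω : IsPrimitiveRoot ω p := by
    have h1 : IsPrimitiveRoot (ζ ^ n) p := hζ.pow hm0 (by rw [hm, mul_comm])
    rw [hωdef, hNdef, pow_mul]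
    exact h1.pow_of_coprime t ((Nat.Prime.coprime_iff_not_dvd hp).2 ht).symm
  have hpowj : ∀ j : ℕ, ζ ^ (1 + N) ^ j = ζ * ω ^ j := by
    intro j
    rw [pow_eq_pow_of_mod_eq hζ.pow_eq_one (pow_one_add_pow_mod hN2 j), pow_add, pow_one, hωdef, ← pow_mul,
      mul_comm j N]
  -- the trace identity
  have htrace := sum_aeval_mul_pow_eq hp hω ζ g
  have hleft : ∑ j ∈ range p, aeval (ζ * ω ^ j) g = (p : ℂ) * aeval ζ g := by
    rw [Finset.sum_congr rfl fun j _ => by rw [← hpowj j, hiter j], Finset.sum_const, Finset.card_range,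
      nsmul_eq_mul]
  rw [hleft] at htrace
  have hp0 : (p : ℂ) ≠ 0 := by exact_mod_cast hp.ne_zero
  exact mul_left_cancel₀ hp0 htrace

end Summit.Ventures.DiscreteObjects.Mahler
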